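import Summits.CriticalPhenomena.PercolationContinuityZ3.Theorems.PercNearOneGluingNoHeavyLowerTailSahiCombTriWFaceSplit

/-!
# FACE-MIN with room to spare at every coordinate the test set ignores

Support file of the one-cut programme (crux `NoHeavyLowerTail`, stmt-CriticalPhenomena-4575; cell `prim-masterthm`, seat P5 gen 25;
memo `FROM-prim-masterthm-p5-g25-CYLINDER-CLOSURE.md` §2f).  Companion of `…SahiCombTriWFaceMin` (`FaceMinExistsIneq`, the surviving inductive
form of `TriWIneq`) and `…SahiCombTriWFaceSplit` (the two-level identity `triW_eq_psi_faces`).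

Write `B = triW P⁰ F⁰ G⁰`, `U = triW P¹ F¹ G¹` for the two face functionals along a coordinate `i` and `T = triW P F G`.  The two-level identity
says `T = ψ(P¹; F¹,G¹ | F⁰,G⁰) + ψ(P⁰; F⁰,G⁰ | F¹,G¹)`.  Here we evaluate the "twisted minus untwisted" combination of `ψ`-terms exactly:

* **`psiTerm_twist_sub`** — for families with `F⁰ x ⊆ F¹ x`, `G⁰ x ⊆ G¹ x` (shells `D_F(x) = F¹ x ∖ F⁰ x`, `D_G = G¹ ∖ G⁰`) and ANY test family `S`:
  `ψ_x(S;F¹,G¹|F⁰,G⁰) + ψ_x(S;F⁰,G⁰|F¹,G¹) − ψ_x(S;F⁰,G⁰|F⁰,G⁰) − ψ_x(S;F¹,G¹|F¹,G¹) = #(S ∩ refl D_F(x) ∩ D_G(xᶜ)) + #(S ∩ D_F(x) ∩ refl D_G(xᶜ))`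
  (two non-negative shell-overlap counts; the pure and the doubly-antipodal terms cancel);
* **`triW_eq_faces_add_of_faceBot_eq_faceTop`** — if the TEST SET ignores `i` (`faceBot i P = faceTop i P`; the families are arbitrary monotone
  families of up-sets) then `T = B + U + Σ_x [#(S ∩ refl D_F(x) ∩ D_G(xᶜ)) + #(S ∩ D_F(x) ∩ refl D_G(xᶜ))]` with `S` the common face of `P` and
  `D_F, D_G` the FIBRE shells (top face minus bottom face) — so **`B + U ≤ T`** (`triW_faces_add_le_of_faceBot_eq_faceTop`): at such a coordinate the
  face-minimum inequality holds in the strong SUM form, for every index cube (compare: the universal per-coordinate form `FaceMinIneq` is false in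
  general, `not_faceMinIneq`);
* `faceBot_eq_faceTop_of_forall` — the hypothesis from the pointwise statement "`s ∈ P ↔ insert i s ∈ P` for `i ∉ s`";
  `faceBot_subset_faceTop` — for an up-set the bottom face lies inside the top face (the shells are genuine differences);
* **`faceMin_of_faceBot_eq_faceTop`** — the `FaceMinExistsIneq`-shaped corollary `min B U ≤ T` at an ignored coordinate, given `0 ≤ U`
  (in the induction of `triWIneq_of_faceMinExistsIneq` both face values are non-negative by the induction hypothesis).

So a counterexample to `FaceMinExistsIneq` must have a test set depending on every coordinate (consistent with cylinder closure,
`…SahiCombTriWCylinderClosure`, which is the same phenomenon on the functional itself).  HONEST LABEL: unconditional identities and one stratum of the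
face-minimum statement; `FaceMinExistsIneq` and `TriWIneq` remain OPEN. [this work]
-/

namespace Summit.CriticalPhenomena.PercolationContinuityZ3.Theorems

namespace FiveUpSet

open Finset

variable {β γ : Type} [DecidableEq β] [Fintype β] [DecidableEq γ] [Fintype γ]

omit [Fintype β] [DecidableEq β] in
/-- `refl` is monotone for inclusion (local copy). [folklore] -/
private theorem refl_mono_local {𝒜 ℬ : Finset (Finset γ)} (h : 𝒜 ⊆ ℬ) : refl 𝒜 ⊆ refl ℬ := by
  intro s hs
  rw [mem_refl] at hs ⊢
  exact h hs

/-- **The twisted-minus-untwisted `ψ` combination is a sum of two shell overlaps.**  For families with `F⁰ x ⊆ F¹ x` and `G⁰ xᶜ ⊆ G¹ xᶜ`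
and any test family `S`:
`ψ_x(S;F¹,G¹|F⁰,G⁰) + ψ_x(S;F⁰,G⁰|F¹,G¹) − ψ_x(S;F⁰,G⁰|F⁰,G⁰) − ψ_x(S;F¹,G¹|F¹,G¹) = #(S ∩ refl(F¹x∖F⁰x) ∩ (G¹xᶜ∖G⁰xᶜ)) + #(S ∩ (F¹x∖F⁰x) ∩ refl(G¹xᶜ∖G⁰xᶜ))`.
[this work] -/
theorem psiTerm_twist_sub (S : Finset (Finset γ)) (Flo Fhi Glo Ghi : Finset β → Finset (Finset γ)) (x : Finset β)
    (hF : Flo x ⊆ Fhi x) (hG : Glo xᶜ ⊆ Ghi xᶜ) :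
    psiTerm S Fhi Ghi Flo Glo x + psiTerm S Flo Glo Fhi Ghi x - psiTerm S Flo Glo Flo Glo x - psiTerm S Fhi Ghi Fhi Ghi x
      = ((S ∩ refl (Fhi x \ Flo x) ∩ (Ghi xᶜ \ Glo xᶜ)).card : ℤ) + (S ∩ (Fhi x \ Flo x) ∩ refl (Ghi xᶜ \ Glo xᶜ)).card := by
  have h1 := card_shell_inter_add S (refl (Flo x)) (refl (Fhi x)) (Glo xᶜ) (Ghi xᶜ) (refl_mono_local hF) hG
  have h2 := card_shell_inter_add S (Flo x) (Fhi x) (refl (Glo xᶜ)) (refl (Ghi xᶜ)) hF (refl_mono_local hG)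
  rw [← refl_sdiff] at h1 h2
  unfold psiTerm
  have h1' : ((S ∩ refl (Fhi x \ Flo x) ∩ (Ghi xᶜ \ Glo xᶜ)).card : ℤ) + (S ∩ refl (Fhi x) ∩ Glo xᶜ).card + (S ∩ refl (Flo x) ∩ Ghi xᶜ).card
      = (S ∩ refl (Fhi x) ∩ Ghi xᶜ).card + (S ∩ refl (Flo x) ∩ Glo xᶜ).card := by exact_mod_cast h1
  have h2' : ((S ∩ (Fhi x \ Flo x) ∩ refl (Ghi xᶜ \ Glo xᶜ)).card : ℤ) + (S ∩ Fhi x ∩ refl (Glo xᶜ)).card + (S ∩ Flo x ∩ refl (Ghi xᶜ)).card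
      = (S ∩ Fhi x ∩ refl (Ghi xᶜ)).card + (S ∩ Flo x ∩ refl (Glo xᶜ)).card := by exact_mod_cast h2
  linarith

/-- Summed form: `ψ(S;F¹,G¹|F⁰,G⁰) + ψ(S;F⁰,G⁰|F¹,G¹) = triW S F⁰ G⁰ + triW S F¹ G¹ + Σ_x [two shell overlaps]` for pointwise nested families
`F⁰ ≤ F¹`, `G⁰ ≤ G¹`. [this work] -/
theorem psi_twist_eq (S : Finset (Finset γ)) (Flo Fhi Glo Ghi : Finset β → Finset (Finset γ))
    (hF : ∀ x, Flo x ⊆ Fhi x) (hG : ∀ x, Glo x ⊆ Ghi x) :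
    psi S Fhi Ghi Flo Glo + psi S Flo Glo Fhi Ghi
      = triW S Flo Glo + triW S Fhi Ghi
        + ∑ x : Finset β, (((S ∩ refl (Fhi x \ Flo x) ∩ (Ghi xᶜ \ Glo xᶜ)).card : ℤ) + (S ∩ (Fhi x \ Flo x) ∩ refl (Ghi xᶜ \ Glo xᶜ)).card) := by
  rw [← psi_self, ← psi_self]
  unfold psi
  rw [← sum_add_distrib, ← sum_add_distrib, ← sum_add_distrib]
  refine sum_congr rfl fun x _ => ?_
  have h := psiTerm_twist_sub S Flo Fhi Glo Ghi x (hF x) (hG xᶜ)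
  linarith

/-- For an up-set, the bottom face along `i` lies inside the top face (`s ∈ 𝒜, i ∉ s ⟹ insert i s ∈ 𝒜`). [this work] -/
theorem faceBot_subset_faceTop (i : γ) {𝒜 : Finset (Finset γ)} (h : IsUpperSet (𝒜 : Set (Finset γ))) :
    faceBot i 𝒜 ⊆ faceTop i 𝒜 := by
  intro s hs
  rw [mem_faceBot] at hs
  rw [mem_faceTop]
  exact h (subset_insert i _) hs

omit [Fintype γ] in
/-- If membership in `P` does not depend on the coordinate `i` (`s ∈ P ↔ insert i s ∈ P` whenever `i ∉ s`), the two faces of `P` along `i`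
coincide. [this work] -/
theorem faceBot_eq_faceTop_of_forall [Fintype γ] (i : γ) {P : Finset (Finset γ)} (h : ∀ s : Finset γ, i ∉ s → (s ∈ P ↔ insert i s ∈ P)) :
    faceBot i P = faceTop i P := by
  ext s
  rw [mem_faceBot, mem_faceTop]
  exact h _ (not_mem_faceLift i s)

/-- **The face functionals at an ignored coordinate, exactly.**  If the test set ignores `i` (`faceBot i P = faceTop i P =: S`) then for all
monotone families of up-sets (restricted faces `F⁰ = faceBot ∘ F ⊆ F¹ = faceTop ∘ F`, likewise `G`):
`triW P F G = triW S F⁰ G⁰ + triW S F¹ G¹ + Σ_x [#(S ∩ refl D_F(x) ∩ D_G(xᶜ)) + #(S ∩ D_F(x) ∩ refl D_G(xᶜ))]`, `D = ¹ ∖ ⁰` the fibre shells.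
[this work] -/
theorem triW_eq_faces_add_of_faceBot_eq_faceTop (i : γ) (P : Finset (Finset γ)) (F G : Finset β → Finset (Finset γ))
    (hF : ∀ x, IsUpperSet (F x : Set (Finset γ))) (hG : ∀ x, IsUpperSet (G x : Set (Finset γ))) (hP : faceBot i P = faceTop i P) :
    triW P F G
      = triW (faceBot i P) (fun x => faceBot i (F x)) (fun x => faceBot i (G x))
        + triW (faceTop i P) (fun x => faceTop i (F x)) (fun x => faceTop i (G x))
        + ∑ x : Finset β, (((faceBot i P ∩ refl (faceTop i (F x) \ faceBot i (F x)) ∩ (faceTop i (G xᶜ) \ faceBot i (G xᶜ))).card : ℤ)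
            + (faceBot i P ∩ (faceTop i (F x) \ faceBot i (F x)) ∩ refl (faceTop i (G xᶜ) \ faceBot i (G xᶜ))).card) := by
  rw [triW_eq_psi_faces i P F G, ← hP]
  have key := psi_twist_eq (faceBot i P) (fun x => faceBot i (F x)) (fun x => faceTop i (F x))
    (fun x => faceBot i (G x)) (fun x => faceTop i (G x)) (fun x => faceBot_subset_faceTop i (hF x)) (fun x => faceBot_subset_faceTop i (hG x))
  linarith [key]

/-- **`B + U ≤ T` at an ignored coordinate**: if `faceBot i P = faceTop i P` then, for all monotone families of up-sets on any index cube,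
`triW P⁰ F⁰ G⁰ + triW P¹ F¹ G¹ ≤ triW P F G` (the SUM form of the face-minimum inequality; no sign hypothesis needed). [this work] -/
theorem triW_faces_add_le_of_faceBot_eq_faceTop (i : γ) (P : Finset (Finset γ)) (F G : Finset β → Finset (Finset γ))
    (hF : ∀ x, IsUpperSet (F x : Set (Finset γ))) (hG : ∀ x, IsUpperSet (G x : Set (Finset γ))) (hP : faceBot i P = faceTop i P) :
    triW (faceBot i P) (fun x => faceBot i (F x)) (fun x => faceBot i (G x))
        + triW (faceTop i P) (fun x => faceTop i (F x)) (fun x => faceTop i (G x)) ≤ triW P F G := by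
  rw [triW_eq_faces_add_of_faceBot_eq_faceTop i P F G hF hG hP]
  have hsum : 0 ≤ ∑ x : Finset β, (((faceBot i P ∩ refl (faceTop i (F x) \ faceBot i (F x)) ∩ (faceTop i (G xᶜ) \ faceBot i (G xᶜ))).card : ℤ)
            + (faceBot i P ∩ (faceTop i (F x) \ faceBot i (F x)) ∩ refl (faceTop i (G xᶜ) \ faceBot i (G xᶜ))).card) :=
    sum_nonneg fun x _ => by positivity
  linarith

/-- **The face-minimum inequality at an ignored coordinate** (the shape used by `FaceMinExistsIneq`): if `faceBot i P = faceTop i P` and the top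
face value is non-negative (as it is inside the induction of `triWIneq_of_faceMinExistsIneq`), then `min B U ≤ triW P F G`. [this work] -/
theorem faceMin_of_faceBot_eq_faceTop (i : γ) (P : Finset (Finset γ)) (F G : Finset β → Finset (Finset γ))
    (hF : ∀ x, IsUpperSet (F x : Set (Finset γ))) (hG : ∀ x, IsUpperSet (G x : Set (Finset γ))) (hP : faceBot i P = faceTop i P)
    (hU : 0 ≤ triW (faceTop i P) (fun x => faceTop i (F x)) (fun x => faceTop i (G x))) :
    min (triW (faceBot i P) (fun x => faceBot i (F x)) (fun x => faceBot i (G x)))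
        (triW (faceTop i P) (fun x => faceTop i (F x)) (fun x => faceTop i (G x))) ≤ triW P F G := by
  have h := triW_faces_add_le_of_faceBot_eq_faceTop i P F G hF hG hP
  have hmin := min_le_left (triW (faceBot i P) (fun x => faceBot i (F x)) (fun x => faceBot i (G x)))
    (triW (faceTop i P) (fun x => faceTop i (F x)) (fun x => faceTop i (G x)))
  linarith

/-! ### The general face excess (appended): `T − B − U` = shell overlaps on the bottom face + the antipodal-shrink defect on the test shell

For an ARBITRARY up-set `P` (faces `P⁰ = faceBot i P ⊆ P¹ = faceTop i P`, test shell `D_P = P¹ ∖ P⁰`) the two-level identity, the additivity of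
`ψ` in the test set and `psi_twist_eq` on `P⁰` give the exact FACE EXCESS
  `T − B − U = Σ_x [#(P⁰ ∩ refl D_F(x) ∩ D_G(xᶜ)) + #(P⁰ ∩ D_F(x) ∩ refl D_G(xᶜ))] + [ψ(D_P; F¹,G¹ | F⁰,G⁰) − ψ(D_P; F¹,G¹ | F¹,G¹)]`
(`triW_sub_faces_eq`): the first sum is `≥ 0`, the last bracket — the effect, on the test shell only, of shrinking the antipodal families from the
top to the bottom faces — is the only possibly negative part, and it is bounded below by minus the growth of the antipodal box
`refl(F x) ∩ refl(G xᶜ)` on `D_P` (`psiTerm_shrink_add_box_nonneg`).  Hence **`B + U ≤ T + R_i`** with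
`R_i = Σ_x [#(D_P ∩ refl(F¹x) ∩ refl(G¹xᶜ)) − #(D_P ∩ refl(F⁰x) ∩ refl(G⁰xᶜ))]` (`triW_faces_add_le_add_shellBox`): the ONLY obstruction to the
sum form of the face-minimum inequality at `i` is this box growth on the shell of the test set (zero when `P` ignores `i`, recovering
`triW_faces_add_le_of_faceBot_eq_faceTop`).  Memo §2f (Ω-form `T = B + U + Q − R`). [this work] -/

omit [Fintype γ] in
/-- Splitting a test-set count along `S₀ ⊆ S₁`: `#(S₁ ∩ A ∩ B) = #(S₀ ∩ A ∩ B) + #((S₁ ∖ S₀) ∩ A ∩ B)`. [folklore] -/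
theorem card_inter_inter_split {S₀ S₁ : Finset (Finset γ)} (h : S₀ ⊆ S₁) (A B : Finset (Finset γ)) :
    (S₁ ∩ A ∩ B).card = (S₀ ∩ A ∩ B).card + ((S₁ \ S₀) ∩ A ∩ B).card := by
  rw [← card_union_of_disjoint]
  · congr 1
    ext s
    simp only [mem_inter, mem_union, mem_sdiff]
    constructor
    · rintro ⟨⟨hs1, hA⟩, hB⟩
      by_cases hs0 : s ∈ S₀
      · exact Or.inl ⟨⟨hs0, hA⟩, hB⟩
      · exact Or.inr ⟨⟨⟨hs1, hs0⟩, hA⟩, hB⟩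
    · rintro (⟨⟨hs0, hA⟩, hB⟩ | ⟨⟨⟨hs1, _⟩, hA⟩, hB⟩)
      · exact ⟨⟨h hs0, hA⟩, hB⟩
      · exact ⟨⟨hs1, hA⟩, hB⟩
  · rw [disjoint_left]
    rintro s hs hs'
    simp only [mem_inter, mem_sdiff] at hs hs'
    exact hs'.1.1.2 hs.1.1

/-- `psiTerm` is additive in the test set: for `S₀ ⊆ S₁`, `ψ_x(S₁;…) = ψ_x(S₀;…) + ψ_x(S₁∖S₀;…)`. [this work] -/
theorem psiTerm_split {S₀ S₁ : Finset (Finset γ)} (h : S₀ ⊆ S₁) (F G F' G' : Finset β → Finset (Finset γ)) (x : Finset β) :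
    psiTerm S₁ F G F' G' x = psiTerm S₀ F G F' G' x + psiTerm (S₁ \ S₀) F G F' G' x := by
  unfold psiTerm
  rw [card_inter_inter_split h (F x) (G x), card_inter_inter_split h (refl (F' x)) (G xᶜ), card_inter_inter_split h (F x) (refl (G' xᶜ)),
    card_inter_inter_split h (refl (F' x)) (refl (G' x)), card_inter_inter_split h (refl (F' x)) (refl (G' xᶜ))]
  push_cast
  ring

/-- `psi` is additive in the test set. [this work] -/
theorem psi_split {S₀ S₁ : Finset (Finset γ)} (h : S₀ ⊆ S₁) (F G F' G' : Finset β → Finset (Finset γ)) :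
    psi S₁ F G F' G' = psi S₀ F G F' G' + psi (S₁ \ S₀) F G F' G' := by
  unfold psi
  rw [← sum_add_distrib]
  exact sum_congr rfl fun x _ => psiTerm_split h F G F' G' x

/-- **The face excess, exactly.**  For an up-set `P` and monotone families of up-sets `F, G` (faces along `i`: `P⁰ ⊆ P¹`, `F⁰ ≤ F¹`, `G⁰ ≤ G¹`,
test shell `D_P = P¹ ∖ P⁰`):
`triW P F G − triW P⁰ F⁰ G⁰ − triW P¹ F¹ G¹ = Σ_x [#(P⁰ ∩ refl D_F(x) ∩ D_G(xᶜ)) + #(P⁰ ∩ D_F(x) ∩ refl D_G(xᶜ))] + [ψ(D_P;F¹,G¹|F⁰,G⁰) − ψ(D_P;F¹,G¹|F¹,G¹)]`.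
[this work] -/
theorem triW_sub_faces_eq (i : γ) (P : Finset (Finset γ)) (F G : Finset β → Finset (Finset γ)) (hP : IsUpperSet (P : Set (Finset γ)))
    (hF : ∀ x, IsUpperSet (F x : Set (Finset γ))) (hG : ∀ x, IsUpperSet (G x : Set (Finset γ))) :
    triW P F G - triW (faceBot i P) (fun x => faceBot i (F x)) (fun x => faceBot i (G x))
        - triW (faceTop i P) (fun x => faceTop i (F x)) (fun x => faceTop i (G x))
      = (∑ x : Finset β, (((faceBot i P ∩ refl (faceTop i (F x) \ faceBot i (F x)) ∩ (faceTop i (G xᶜ) \ faceBot i (G xᶜ))).card : ℤ)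
            + (faceBot i P ∩ (faceTop i (F x) \ faceBot i (F x)) ∩ refl (faceTop i (G xᶜ) \ faceBot i (G xᶜ))).card))
        + (psi (faceTop i P \ faceBot i P) (fun x => faceTop i (F x)) (fun x => faceTop i (G x)) (fun x => faceBot i (F x)) (fun x => faceBot i (G x))
           - psi (faceTop i P \ faceBot i P) (fun x => faceTop i (F x)) (fun x => faceTop i (G x)) (fun x => faceTop i (F x)) (fun x => faceTop i (G x))) := by
  have hPP := faceBot_subset_faceTop i hP
  have hT := triW_eq_psi_faces i P F G
  have h1 := psi_split hPP (fun x => faceTop i (F x)) (fun x => faceTop i (G x)) (fun x => faceBot i (F x)) (fun x => faceBot i (G x))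
  have h2 := psi_split hPP (fun x => faceTop i (F x)) (fun x => faceTop i (G x)) (fun x => faceTop i (F x)) (fun x => faceTop i (G x))
  have h3 := psi_twist_eq (faceBot i P) (fun x => faceBot i (F x)) (fun x => faceTop i (F x))
    (fun x => faceBot i (G x)) (fun x => faceTop i (G x)) (fun x => faceBot_subset_faceTop i (hF x)) (fun x => faceBot_subset_faceTop i (hG x))
  have hU : triW (faceTop i P) (fun x => faceTop i (F x)) (fun x => faceTop i (G x))
      = psi (faceTop i P) (fun x => faceTop i (F x)) (fun x => faceTop i (G x)) (fun x => faceTop i (F x)) (fun x => faceTop i (G x)) :=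
    (psi_self _ _ _).symm
  have hB0 : triW (faceBot i P) (fun x => faceTop i (F x)) (fun x => faceTop i (G x))
      = psi (faceBot i P) (fun x => faceTop i (F x)) (fun x => faceTop i (G x)) (fun x => faceTop i (F x)) (fun x => faceTop i (G x)) :=
    (psi_self _ _ _).symm
  linarith

/-- Termwise lower bound for the antipodal-shrink defect: shrinking the antipodal families from `(F¹,G¹)` to `(F⁰,G⁰)` (`F⁰ x ⊆ F¹ x`, `G⁰ ≤ G¹`)
lowers `ψ_x(D;F¹,G¹|·,·)` by at most the growth of the antipodal box:
`ψ_x(D;F¹,G¹|F⁰,G⁰) − ψ_x(D;F¹,G¹|F¹,G¹) + [#(D ∩ refl(F¹x) ∩ refl(G¹xᶜ)) − #(D ∩ refl(F⁰x) ∩ refl(G⁰xᶜ))] ≥ 0`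
(the three other affected terms only grow). [this work] -/
theorem psiTerm_shrink_add_box_nonneg (D : Finset (Finset γ)) (Flo Fhi Glo Ghi : Finset β → Finset (Finset γ)) (x : Finset β)
    (hF : Flo x ⊆ Fhi x) (hG : Glo x ⊆ Ghi x) (hG' : Glo xᶜ ⊆ Ghi xᶜ) :
    0 ≤ psiTerm D Fhi Ghi Flo Glo x - psiTerm D Fhi Ghi Fhi Ghi x
        + (((D ∩ refl (Fhi x) ∩ refl (Ghi xᶜ)).card : ℤ) - (D ∩ refl (Flo x) ∩ refl (Glo xᶜ)).card) := by
  have a1 : (D ∩ refl (Flo x) ∩ Ghi xᶜ).card ≤ (D ∩ refl (Fhi x) ∩ Ghi xᶜ).card :=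
    card_le_card (inter_subset_inter (inter_subset_inter_left (refl_mono_local hF)) subset_rfl)
  have a2 : (D ∩ Fhi x ∩ refl (Glo xᶜ)).card ≤ (D ∩ Fhi x ∩ refl (Ghi xᶜ)).card :=
    card_le_card (inter_subset_inter subset_rfl (refl_mono_local hG'))
  have a3 : (D ∩ refl (Flo x) ∩ refl (Glo x)).card ≤ (D ∩ refl (Fhi x) ∩ refl (Ghi x)).card :=
    card_le_card (inter_subset_inter (inter_subset_inter_left (refl_mono_local hF)) (refl_mono_local hG))
  unfold psiTerm
  linarith [Int.ofNat_le.2 a1, Int.ofNat_le.2 a2, Int.ofNat_le.2 a3]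

/-- **`B + U ≤ T + R_i`** for every coordinate `i`: with `D_P = faceTop i P ∖ faceBot i P` the test shell and
`R_i = Σ_x [#(D_P ∩ refl(F¹x) ∩ refl(G¹xᶜ)) − #(D_P ∩ refl(F⁰x) ∩ refl(G⁰xᶜ))]` (growth of the antipodal box on the test shell),
`triW P⁰ F⁰ G⁰ + triW P¹ F¹ G¹ ≤ triW P F G + R_i` for every up-set `P` and all monotone families of up-sets on any index cube.
`R_i = 0` when `P` ignores `i` (`D_P = ∅`). [this work] -/
theorem triW_faces_add_le_add_shellBox (i : γ) (P : Finset (Finset γ)) (F G : Finset β → Finset (Finset γ))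
    (hP : IsUpperSet (P : Set (Finset γ))) (hF : ∀ x, IsUpperSet (F x : Set (Finset γ))) (hG : ∀ x, IsUpperSet (G x : Set (Finset γ))) :
    triW (faceBot i P) (fun x => faceBot i (F x)) (fun x => faceBot i (G x))
        + triW (faceTop i P) (fun x => faceTop i (F x)) (fun x => faceTop i (G x))
      ≤ triW P F G + ∑ x : Finset β, (((( faceTop i P \ faceBot i P) ∩ refl (faceTop i (F x)) ∩ refl (faceTop i (G xᶜ))).card : ℤ)
            - ((faceTop i P \ faceBot i P) ∩ refl (faceBot i (F x)) ∩ refl (faceBot i (G xᶜ))).card) := by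
  have hex := triW_sub_faces_eq i P F G hP hF hG
  have hov : 0 ≤ ∑ x : Finset β, (((faceBot i P ∩ refl (faceTop i (F x) \ faceBot i (F x)) ∩ (faceTop i (G xᶜ) \ faceBot i (G xᶜ))).card : ℤ)
            + (faceBot i P ∩ (faceTop i (F x) \ faceBot i (F x)) ∩ refl (faceTop i (G xᶜ) \ faceBot i (G xᶜ))).card) :=
    sum_nonneg fun x _ => by positivity
  have hdef : 0 ≤ psi (faceTop i P \ faceBot i P) (fun x => faceTop i (F x)) (fun x => faceTop i (G x)) (fun x => faceBot i (F x)) (fun x => faceBot i (G x))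
        - psi (faceTop i P \ faceBot i P) (fun x => faceTop i (F x)) (fun x => faceTop i (G x)) (fun x => faceTop i (F x)) (fun x => faceTop i (G x))
        + ∑ x : Finset β, ((((faceTop i P \ faceBot i P) ∩ refl (faceTop i (F x)) ∩ refl (faceTop i (G xᶜ))).card : ℤ)
            - ((faceTop i P \ faceBot i P) ∩ refl (faceBot i (F x)) ∩ refl (faceBot i (G xᶜ))).card) := by
    unfold psi
    rw [← sum_sub_distrib, ← sum_add_distrib]
    exact sum_nonneg fun x _ => psiTerm_shrink_add_box_nonneg _ _ _ _ _ x (faceBot_subset_faceTop i (hF x))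
      (faceBot_subset_faceTop i (hG x)) (faceBot_subset_faceTop i (hG xᶜ))
  linarith

/-! ### The defect in HARRIS-GAP form (appended)

Expanding the antipodal-shrink defect termwise: the two single-shell terms are non-negative, and the two doubly-antipodal terms combine into a
DIFFERENCE OF HARRIS GAPS.  For a test family `D` and a pair of monotone families `(F, G)` put
`H(D;F,G) = Σ_x [#(D ∩ refl(F x) ∩ refl(G x)) − #(D ∩ refl(F x) ∩ refl(G xᶜ))]` — pointwise in `ω ∈ D` this is `Σ_x f(x)g(x) − Σ_x f(x)g(xᶜ)` for the
increasing indicators `f(x) = [ωᶜ ∈ F x]`, `g(x) = [ωᶜ ∈ G x]` on the index cube, i.e. a Harris/Kleitman correlation gap (non-negative; not needed here).  Then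
  `ψ_x(D;F¹,G¹|F⁰,G⁰) − ψ_x(D;F¹,G¹|F¹,G¹) = #(D ∩ refl D_F(x) ∩ G¹xᶜ) + #(D ∩ F¹x ∩ refl D_G(xᶜ)) + [h_x(F¹,G¹) − h_x(F⁰,G⁰)]`   (`psiTerm_shrink_eq`)
with `h_x(F,G) = #(D ∩ refl(F x) ∩ refl(G x)) − #(D ∩ refl(F x) ∩ refl(G xᶜ))`, and summing (`triW_sub_faces_eq_harris`):
  **`T − B_i − U_i = Σ_x [#(P⁰∩refl D_F∩D_G(xᶜ)) + #(P⁰∩D_F∩refl D_G(xᶜ)) + #(D_P∩refl D_F∩G¹xᶜ) + #(D_P∩F¹x∩refl D_G(xᶜ))] + H(D_P;F¹,G¹) − H(D_P;F⁰,G⁰)`**: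
the ONLY possibly negative contribution to the face excess at `i` is a DROP of the Harris gap, over the test shell `D_P`, from the top-face families to
the bottom-face families.  Corollary `triW_faces_add_le_of_harrisGap_le`: if the gap does not drop (`H(D_P;F⁰,G⁰) ≤ H(D_P;F¹,G¹)`) then `B_i + U_i ≤ T`.
(For `#β = 0` the two gaps vanish identically — `x = xᶜ` — so the sum form holds at every coordinate; memo §2g.) [this work] -/

omit [Fintype β] [DecidableEq β] [Fintype γ] in
/-- Single-shell difference of box counts: for `A₀ ⊆ A₁`, `#(S ∩ A₁ ∩ C) − #(S ∩ A₀ ∩ C) = #(S ∩ (A₁ ∖ A₀) ∩ C)`. [folklore] -/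
theorem card_inter_shell_left (S A₀ A₁ C : Finset (Finset γ)) (h : A₀ ⊆ A₁) :
    ((S ∩ A₁ ∩ C).card : ℤ) - (S ∩ A₀ ∩ C).card = (S ∩ (A₁ \ A₀) ∩ C).card := by
  have hsub : S ∩ A₀ ∩ C ⊆ S ∩ A₁ ∩ C := inter_subset_inter (inter_subset_inter subset_rfl h) subset_rfl
  have hsd : (S ∩ A₁ ∩ C) \ (S ∩ A₀ ∩ C) = S ∩ (A₁ \ A₀) ∩ C := by
    ext s
    simp only [mem_sdiff, mem_inter]
    constructor
    · rintro ⟨⟨⟨hS, hA1⟩, hC⟩, hnot⟩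
      exact ⟨⟨hS, hA1, fun hA0 => hnot ⟨⟨hS, hA0⟩, hC⟩⟩, hC⟩
    · rintro ⟨⟨hS, hA1, hA0⟩, hC⟩
      exact ⟨⟨⟨hS, hA1⟩, hC⟩, fun h' => hA0 h'.1.2⟩
  have hc := card_sdiff_add_card_eq_card hsub
  rw [hsd] at hc
  have hc' : ((S ∩ (A₁ \ A₀) ∩ C).card : ℤ) + (S ∩ A₀ ∩ C).card = (S ∩ A₁ ∩ C).card := by exact_mod_cast hc
  linarith

omit [Fintype β] [DecidableEq β] [Fintype γ] in
/-- Single-shell difference of box counts in the last slot: for `C₀ ⊆ C₁`, `#(S ∩ A ∩ C₁) − #(S ∩ A ∩ C₀) = #(S ∩ A ∩ (C₁ ∖ C₀))`. [folklore] -/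
theorem card_inter_shell_right (S A C₀ C₁ : Finset (Finset γ)) (h : C₀ ⊆ C₁) :
    ((S ∩ A ∩ C₁).card : ℤ) - (S ∩ A ∩ C₀).card = (S ∩ A ∩ (C₁ \ C₀)).card := by
  have hsub : S ∩ A ∩ C₀ ⊆ S ∩ A ∩ C₁ := inter_subset_inter subset_rfl h
  have hsd : (S ∩ A ∩ C₁) \ (S ∩ A ∩ C₀) = S ∩ A ∩ (C₁ \ C₀) := by
    ext s
    simp only [mem_sdiff, mem_inter]
    constructor
    · rintro ⟨⟨hSA, hC1⟩, hnot⟩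
      exact ⟨hSA, hC1, fun hC0 => hnot ⟨hSA, hC0⟩⟩
    · rintro ⟨hSA, hC1, hC0⟩
      exact ⟨⟨hSA, hC1⟩, fun h' => hC0 h'.2⟩
  have hc := card_sdiff_add_card_eq_card hsub
  rw [hsd] at hc
  have hc' : ((S ∩ A ∩ (C₁ \ C₀)).card : ℤ) + (S ∩ A ∩ C₀).card = (S ∩ A ∩ C₁).card := by exact_mod_cast hc
  linarith

/-- **The antipodal-shrink defect, termwise, in Harris-gap form**: for `F⁰ x ⊆ F¹ x`, `G⁰ xᶜ ⊆ G¹ xᶜ`,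
`ψ_x(D;F¹,G¹|F⁰,G⁰) − ψ_x(D;F¹,G¹|F¹,G¹) = #(D ∩ refl(F¹x∖F⁰x) ∩ G¹xᶜ) + #(D ∩ F¹x ∩ refl(G¹xᶜ∖G⁰xᶜ))`
`+ [#(D ∩ refl F¹x ∩ refl G¹x) − #(D ∩ refl F¹x ∩ refl G¹xᶜ)] − [#(D ∩ refl F⁰x ∩ refl G⁰x) − #(D ∩ refl F⁰x ∩ refl G⁰xᶜ)]`. [this work] -/
theorem psiTerm_shrink_eq (D : Finset (Finset γ)) (Flo Fhi Glo Ghi : Finset β → Finset (Finset γ)) (x : Finset β)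
    (hF : Flo x ⊆ Fhi x) (hG' : Glo xᶜ ⊆ Ghi xᶜ) :
    psiTerm D Fhi Ghi Flo Glo x - psiTerm D Fhi Ghi Fhi Ghi x
      = ((D ∩ refl (Fhi x \ Flo x) ∩ Ghi xᶜ).card : ℤ) + (D ∩ Fhi x ∩ refl (Ghi xᶜ \ Glo xᶜ)).card
        + ((((D ∩ refl (Fhi x) ∩ refl (Ghi x)).card : ℤ) - (D ∩ refl (Fhi x) ∩ refl (Ghi xᶜ)).card)
           - (((D ∩ refl (Flo x) ∩ refl (Glo x)).card : ℤ) - (D ∩ refl (Flo x) ∩ refl (Glo xᶜ)).card)) := by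
  have h1 := card_inter_shell_left D (refl (Flo x)) (refl (Fhi x)) (Ghi xᶜ) (refl_mono_local hF)
  have h2 := card_inter_shell_right D (Fhi x) (refl (Glo xᶜ)) (refl (Ghi xᶜ)) (refl_mono_local hG')
  rw [← refl_sdiff] at h1 h2
  unfold psiTerm
  linarith

/-- **The face excess in Harris-gap form.**  For an up-set `P` and monotone families of up-sets `F, G` (faces along `i`, test shell
`D_P = faceTop i P ∖ faceBot i P`):
`T − B − U = Σ_x [#(P⁰∩refl D_F(x)∩D_G(xᶜ)) + #(P⁰∩D_F(x)∩refl D_G(xᶜ)) + #(D_P∩refl D_F(x)∩G¹xᶜ) + #(D_P∩F¹x∩refl D_G(xᶜ))]`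
`          + Σ_x [#(D_P∩refl F¹x∩refl G¹x) − #(D_P∩refl F¹x∩refl G¹xᶜ)] − Σ_x [#(D_P∩refl F⁰x∩refl G⁰x) − #(D_P∩refl F⁰x∩refl G⁰xᶜ)]`
— four non-negative shell terms plus the top-face Harris gap minus the bottom-face Harris gap over the test shell. [this work] -/
theorem triW_sub_faces_eq_harris (i : γ) (P : Finset (Finset γ)) (F G : Finset β → Finset (Finset γ)) (hP : IsUpperSet (P : Set (Finset γ)))
    (hF : ∀ x, IsUpperSet (F x : Set (Finset γ))) (hG : ∀ x, IsUpperSet (G x : Set (Finset γ))) :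
    triW P F G - triW (faceBot i P) (fun x => faceBot i (F x)) (fun x => faceBot i (G x))
        - triW (faceTop i P) (fun x => faceTop i (F x)) (fun x => faceTop i (G x))
      = (∑ x : Finset β, (((faceBot i P ∩ refl (faceTop i (F x) \ faceBot i (F x)) ∩ (faceTop i (G xᶜ) \ faceBot i (G xᶜ))).card : ℤ)
            + (faceBot i P ∩ (faceTop i (F x) \ faceBot i (F x)) ∩ refl (faceTop i (G xᶜ) \ faceBot i (G xᶜ))).card
            + ((faceTop i P \ faceBot i P) ∩ refl (faceTop i (F x) \ faceBot i (F x)) ∩ faceTop i (G xᶜ)).card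
            + ((faceTop i P \ faceBot i P) ∩ faceTop i (F x) ∩ refl (faceTop i (G xᶜ) \ faceBot i (G xᶜ))).card))
        + ∑ x : Finset β, ((((faceTop i P \ faceBot i P) ∩ refl (faceTop i (F x)) ∩ refl (faceTop i (G x))).card : ℤ)
            - ((faceTop i P \ faceBot i P) ∩ refl (faceTop i (F x)) ∩ refl (faceTop i (G xᶜ))).card)
        - ∑ x : Finset β, ((((faceTop i P \ faceBot i P) ∩ refl (faceBot i (F x)) ∩ refl (faceBot i (G x))).card : ℤ)
            - ((faceTop i P \ faceBot i P) ∩ refl (faceBot i (F x)) ∩ refl (faceBot i (G xᶜ))).card) := by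
  rw [triW_sub_faces_eq i P F G hP hF hG]
  have hdef : psi (faceTop i P \ faceBot i P) (fun x => faceTop i (F x)) (fun x => faceTop i (G x)) (fun x => faceBot i (F x)) (fun x => faceBot i (G x))
        - psi (faceTop i P \ faceBot i P) (fun x => faceTop i (F x)) (fun x => faceTop i (G x)) (fun x => faceTop i (F x)) (fun x => faceTop i (G x))
      = ∑ x : Finset β, ((((faceTop i P \ faceBot i P) ∩ refl (faceTop i (F x) \ faceBot i (F x)) ∩ faceTop i (G xᶜ)).card : ℤ)
          + ((faceTop i P \ faceBot i P) ∩ faceTop i (F x) ∩ refl (faceTop i (G xᶜ) \ faceBot i (G xᶜ))).card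
          + ((((faceTop i P \ faceBot i P) ∩ refl (faceTop i (F x)) ∩ refl (faceTop i (G x))).card : ℤ)
              - ((faceTop i P \ faceBot i P) ∩ refl (faceTop i (F x)) ∩ refl (faceTop i (G xᶜ))).card)
          - ((((faceTop i P \ faceBot i P) ∩ refl (faceBot i (F x)) ∩ refl (faceBot i (G x))).card : ℤ)
              - ((faceTop i P \ faceBot i P) ∩ refl (faceBot i (F x)) ∩ refl (faceBot i (G xᶜ))).card)) := by
    unfold psi
    rw [← sum_sub_distrib]
    refine sum_congr rfl fun x _ => ?_
    have h := psiTerm_shrink_eq (faceTop i P \ faceBot i P) (fun x => faceBot i (F x)) (fun x => faceTop i (F x))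
      (fun x => faceBot i (G x)) (fun x => faceTop i (G x)) x (faceBot_subset_faceTop i (hF x)) (faceBot_subset_faceTop i (hG xᶜ))
    linarith
  rw [hdef]
  simp only [sum_add_distrib, sum_sub_distrib]
  ring

/-- **No Harris-gap drop ⇒ the sum form of FACE-MIN.**  If, over the test shell `D_P` along `i`, the Harris gap of the bottom-face families does not
exceed that of the top-face families, then `triW P⁰ F⁰ G⁰ + triW P¹ F¹ G¹ ≤ triW P F G`. [this work] -/
theorem triW_faces_add_le_of_harrisGap_le (i : γ) (P : Finset (Finset γ)) (F G : Finset β → Finset (Finset γ))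
    (hP : IsUpperSet (P : Set (Finset γ))) (hF : ∀ x, IsUpperSet (F x : Set (Finset γ))) (hG : ∀ x, IsUpperSet (G x : Set (Finset γ)))
    (hgap : ∑ x : Finset β, ((((faceTop i P \ faceBot i P) ∩ refl (faceBot i (F x)) ∩ refl (faceBot i (G x))).card : ℤ)
              - ((faceTop i P \ faceBot i P) ∩ refl (faceBot i (F x)) ∩ refl (faceBot i (G xᶜ))).card)
          ≤ ∑ x : Finset β, ((((faceTop i P \ faceBot i P) ∩ refl (faceTop i (F x)) ∩ refl (faceTop i (G x))).card : ℤ)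
              - ((faceTop i P \ faceBot i P) ∩ refl (faceTop i (F x)) ∩ refl (faceTop i (G xᶜ))).card)) :
    triW (faceBot i P) (fun x => faceBot i (F x)) (fun x => faceBot i (G x))
        + triW (faceTop i P) (fun x => faceTop i (F x)) (fun x => faceTop i (G x)) ≤ triW P F G := by
  have hex := triW_sub_faces_eq_harris i P F G hP hF hG
  have h4 : 0 ≤ ∑ x : Finset β, (((faceBot i P ∩ refl (faceTop i (F x) \ faceBot i (F x)) ∩ (faceTop i (G xᶜ) \ faceBot i (G xᶜ))).card : ℤ)
            + (faceBot i P ∩ (faceTop i (F x) \ faceBot i (F x)) ∩ refl (faceTop i (G xᶜ) \ faceBot i (G xᶜ))).card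
            + ((faceTop i P \ faceBot i P) ∩ refl (faceTop i (F x) \ faceBot i (F x)) ∩ faceTop i (G xᶜ)).card
            + ((faceTop i P \ faceBot i P) ∩ faceTop i (F x) ∩ refl (faceTop i (G xᶜ) \ faceBot i (G xᶜ))).card) :=
    sum_nonneg fun x _ => by positivity
  linarith

end FiveUpSet

end Summit.CriticalPhenomena.PercolationContinuityZ3.Theorems
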